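import Mathlib
import Summits.AtomisticToContinuum.Crystallization.Theses.IsometryAtoms

/-!
# Line `so3-commutator` — crux `IsometryAtoms.AtomicLawChargesCrystal` (stmt-AtomisticToContinuum-15778)

Route `route-AtomisticToContinuum-IsometryAtoms`, sub-problem `Crystallization`; crux workfile
`Cruxes/AtomicLawChargesCrystal/Lines/so3-commutator.lean` (crux-strategist ALTERNATIVE line to
`Lines/birth.lean`, registered with `ledger skeleton check`).

The crux (FIXED — the route's decl and signature, never restated): THE BRIDGE. A probability law `P`
on rooted configurations of `ℝ³`, a.s. `δ`-hard-core, point-stationary (Mecke identity), a.s. relatively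
dense, with an atom modulo isometry at `Y`, charges every `(R, ε)`-window of ONE `Q : PeriodicConfiguration 3`
(in fact `Q.points = Y`).

## Why a second line (what it dodges)

The registered line `birth` ends in `stub_idealCrystalOfFiniteOrbits` = Dolbilin–Lagarias–Senechal
Thm 1.1 at `n = 3`, whose printed proof IS Bieberbach's first theorem for `E(3)`; in the tree Bieberbach I/II
and DLS Thm 1.1 exist only as NAMED FACTS (`def … : Prop`, `Literature.Geometry.DiscreteGeometry.Crystallographic.
Bieberbach_first`, `…DolbilinLagariasSenechal1998_thm1_1`), which a proof of the hypothesis-free crux cannot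
assume — so `birth` silently contains "formalise Bieberbach I" (no Mathlib support: no crystallographic
groups, no Euler rotation theorem API, no structure of discrete subgroups of `E(n)`), preceded by a Voronoi-cell
measure-theoretic finiteness step (`stub_finiteOrbitsOfCubicGrowth`).  This line keeps the Palm half of
`birth` VERBATIM (stubs 1–3: identical statements, so work on them transfers between the two lines) and
replaces the whole geometric half (birth stubs 4–6) by an ELEMENTARY, dimension-three argument that needs
neither Voronoi cells, nor finitely-many-orbits, nor any named fact: Bieberbach I is re-proved for the case at
hand through the commutator geometry of `SO(3)` (two small rotations commute iff they are coaxial) and a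
screw-axis / shortest-vector exclusion.  Technique: Frobenius–Bieberbach commutator contraction, specialised
to `SO(3)` where "commuting" means "same axis", plus the crystallographic-restriction trick (a plane lattice
has no rotation symmetry of angle `< 60°`) run backwards.

## The line (four new stubs G1a, G1b, G2, G3 after the three shared ones)

Notation: `D` a Mathlib `Delone.DeloneSet ℝ³`; `Sym(D) = {g : ℝ³ ≃ᵃⁱ[ℝ] ℝ³ | g '' D = D}`; a symmetry `g`
has SMALL linear part if `‖g.linear x - x‖ ≤ ‖x‖/10` for all `x` (operator norm `≤ 1/10`; any constant
`≤ 1/4` would do — nothing is tuned); CUBIC GROWTH of the orbit of `q ∈ D`: `c·r³ ≤ #(Sym(D)·q ∩ B̄(q, r))`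
for `r ≥ 1` (the verbatim conclusion of the shared stub 3).

* S1 `stub_deloneOfRealisedClass`, S2 `stub_measurableSet_isometryClass`, S3 `stub_cubicGrowthOfChargedClass`
  — VERBATIM the statements of `Lines/birth.lean` stubs 1–3 (extraction of a Delone carrier, Giry
  measurability of a rooted isometry class, and the Palm / mass-transport lever: an atom forces one
  `Sym(D)`-orbit of cubic growth).  See `birth.lean` for their docstrings; the Mecke identity, the a.s.
  hard core and the a.s. relative density are consumed in S1/S3 exactly as there.
* G1a `stub_smallPartsCommute` (L).  For ANY Delone set `D ⊆ ℝ³`, the linear parts of two symmetries of `D`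
  that are both small COMMUTE.  Proof (commutator contraction, no growth needed): if `A₁ = lin g₁`,
  `A₂ = lin g₂` do not commute, the iterated commutators `κ₁ = [g₁, g₂]`, `κ_{j+1} = [g₁, κ_j]` lie in
  `Sym(D)`, have linear parts `C_{j+1} = [A₁, C_j]` with `‖C_{j+1} - I‖ ≤ 2‖A₁ - I‖‖C_j - I‖ ≤ (1/5)ʲ/10` and
  translation parts (origin at a point `q ∈ D`) `b_{j+1} ≤ ‖C_j - I‖·a + (‖A₁ - I‖ + ‖C_{j+1} - I‖)·b_j → 0`
  (`t_[α,β] = (I - ABA⁻¹)a + (A - C)b`), and are ALL non-trivial: in `SO(3)` (small ⇒ no eigenvalue `-1` ⇒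
  proper with a fixed axis) two small rotations commute iff they have the same axis, and
  `C_{j+1} = A₁·Rot(C_j u₁, -θ₁)` fixes `u₁` iff `C_j u₁ = ±u₁` iff (inductively) `C_j` is coaxial with `A₁` —
  false.  But a symmetry of `D` moving every point of `D ∩ B̄(q, ρ₀)` by less than the packing radius fixes
  them, and `D ∩ B̄(q, ρ₀)` affinely spans `ℝ³` (relative density), so `κ_j = 1` for large `j`: contradiction.
* G1b `stub_noSmallRotation` (L).  If some orbit `Sym(D)·q` has cubic growth and small linear parts of
  symmetries pairwise commute (G1a), then every symmetry with small linear part is a TRANSLATION.  Proof: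
  let `g₀ ∈ Sym(D)` have small linear part `A₀ ≠ I`; `A₀` is a rotation by `θ₀ ∈ (0, 0.1]` about an axis
  direction `u`, and `g₀` is a screw motion about a line `ℓ ∥ u` (unique fixed point of `x ↦ A₀x + t_⊥` in
  `u^⊥`).  For every `h ∈ Sym(D)` the conjugate `h g₀ h⁻¹` is small, so its linear part `BA₀B⁻¹` commutes
  with `A₀`, whence `Bu = ±u`: `Sym(D)` preserves the direction `±u`.  (i) If every `h ∈ Sym(D)` maps `ℓ` to
  itself, the orbit of `q` lies on ONE cylinder around `ℓ` and, being uniformly discrete, has `O(r)` points in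
  `B̄(q, r)` — contradicting cubic growth.  (ii) Otherwise `h(ℓ) ∥ ℓ` at distance `d > 0`, `g₁ := h g₀ h⁻¹` is a
  screw of angle `±θ₀` about `h(ℓ)`, the linear parts of `g₀, g₁` commute, so `κ = [g₀, g₁] ∈ Sym(D)` is a
  translation, by `w ⊥ u` with `|w| = d·(2 sin(θ₀/2))² ≠ 0`.  The translation vectors of `Sym(D)` lying in
  `u^⊥` form an `A₀`-invariant (`g₀ τ_v g₀⁻¹ = τ_{A₀ v}`), uniformly discrete (`⊆ D - q`) subgroup containing
  `w`; its shortest non-zero vector `v` has `A₀v - v` non-zero, in the subgroup, and of length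
  `≤ |v|/10 < |v|` — contradiction.  Hence `A₀ = I`.
* G2 `stub_latticeOfNoSmallRotation` (L).  Cubic growth of one orbit + "small linear part ⇒ translation"
  give a FULL-RANK LATTICE of periods: the point group `{lin g}` is `1/10`-separated in operator norm
  (`lin(g g'⁻¹) = AA'⁻¹` small ⇒ `= I`), hence finite of cardinality `≤ h` (a covering number of `O(3)`,
  e.g. a `1/100`-grid on the nine matrix entries); among the `≥ c r³` symmetries `g_p` carrying `q` to the
  orbit points `p ∈ B̄(q, r)` at least `c r³ / h` share one linear part, and `g_p g_{p₀}⁻¹` is then the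
  translation by `p - p₀`: the translation vectors `T = {v | D + v = D}` (an additive subgroup, uniformly
  discrete since `q + T ⊆ D`) have `≥ c r³/h - 1` elements in `B̄(0, 2r)` for every `r ≥ 1`, which a
  uniformly discrete subgroup of a plane cannot (`O(r²)`), so `span_ℝ T = ℝ³`: `T` is a discrete `ℤ`-submodule
  with `IsZLattice`.
* G3 `stub_periodicOfLattice` (M; packaging).  A non-empty uniformly discrete set `Y` invariant under a full
  lattice `L` (`y + v ∈ Y` for `v ∈ L`) is `Q.points` for a `Q : PeriodicConfiguration 3` with
  `Q.lattice = L` and motif `Y ∩ (ZSpan fundamental domain of a basis of L)` (finite: bounded and uniformly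
  discrete; non-empty and exhausting via `ZSpan.fract`; pairwise inequivalent by uniqueness of `fract`).

Composition (sorry-free, proved below): extraction of one realised hard-core relatively dense copy
(`Measure.exists_mem_of_measure_ne_zero_of_ae`) → S1 (Delone `D` with carrier `Y`) → S3 fed by S2 (cubic growth
of `Sym(D)·q`) → G1a → G1b → G2 (lattice `L` of periods) → G3 with the packing radius of `D` (`Q.points = Y`) →
WINDOWS (the atom event lies inside every `(R, ε)`-matching event of `Q`; monotonicity of `P`).
`AtomicLawChargesCrystal_of : AtomicLawChargesCrystal` concludes the route decl BY NAME from the seven stubs.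

Disproof / negatives used: no `Disproof.lean` exists for this crux (`ledger crux ls`); the landed negative
lemma `Theorems/AtomicLawChargesCrystal/Negative/FalseWithoutRelDense.atomicLawChargesCrystal_false_without_relDense`
(any proof must use a.s. relative density) is honoured: relative density is consumed in S1 (covering radius)
and S3 (`#(D ∩ B̄_r) ≥ c₀r³`), and again in G1a (an affinely spanning patch) and G1b/G2 (cubic growth);
`Negative/LatticeLaw.frame_inhabited` (the frame is inhabited by `δ_{count|ℤ³}`) is consistent with every stub
(for `D = ℤ³`: no small rotation in `Sym(ℤ³)`, `T = ℤ³`, `Q.points = ℤ³`).  No stub is an instance refuted by a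
landed Negative lemma; none mentions energy, shells or stackings (the catalogued barriers of the route bite on
PURITY, not on the bridge).
-/

noncomputable section

namespace Summit.AtomisticToContinuum.Crystallization.Cruxes.AtomicLawChargesCrystal.So3Commutator

open MeasureTheory

/-- The crux through its constant (definitional unfolding, for the reader). -/
theorem crux_iff :
    Summit.AtomisticToContinuum.Crystallization.Theses.IsometryAtoms.AtomicLawChargesCrystal ↔
      (∀ δ : ℝ, 0 < δ → ∀ P : MeasureTheory.Measure (MeasureTheory.Measure (EuclideanSpace ℝ (Fin 3))), MeasureTheory.IsProbabilityMeasure P → (∀ᵐ μ ∂P, Literature.Probability.Process.IsRootedHardCore δ μ) → Literature.Probability.Process.IsPointStationaryLaw P → (∀ᵐ μ ∂P, ∃ R₀ : ℝ, ∀ z : EuclideanSpace ℝ (Fin 3), ∃ y : EuclideanSpace ℝ (Fin 3), μ {y} ≠ 0 ∧ dist z y ≤ R₀) → (∃ Y : Set (EuclideanSpace ℝ (Fin 3)), 0 < P {μ | ∃ A : EuclideanSpace ℝ (Fin 3) →ₗᵢ[ℝ] EuclideanSpace ℝ (Fin 3), ∃ q ∈ Y, μ = (MeasureTheory.Measure.count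 : MeasureTheory.Measure (EuclideanSpace ℝ (Fin 3))).restrict ((fun s => A (s - q)) '' Y)}) → ∃ Q : Literature.MathematicalPhysics.StatisticalMechanics.PeriodicConfiguration 3, ∀ R ε : ℝ, 0 < R → 0 < ε → 0 < P {μ | ∃ A : EuclideanSpace ℝ (Fin 3) →ₗᵢ[ℝ] EuclideanSpace ℝ (Fin 3), ∃ q ∈ Q.points, (∀ s ∈ Q.points, dist s q ≤ R → ∃ y : EuclideanSpace ℝ (Fin 3), μ {y} ≠ 0 ∧ dist y (A (s - q)) ≤ ε) ∧ (∀ y : EuclideanSpace ℝ (Fin 3), μ {y} ≠ 0 → ‖y‖ ≤ R → ∃ s ∈ Q.points, dist y (A (s - q)) ≤ ε)}) :=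
  Iff.rfl

/-! ## Shared stubs S1–S3 (statements VERBATIM those of `Lines/birth.lean` stubs 1–3) -/

/-- **S1 (= birth stub 1) — a realised hard-core, relatively dense copy makes `Y` Delone** (size M).
If the rooted copy `count|A(Y − q)` is a rooted `δ`-hard-core configuration (`δ > 0`) and is relatively
dense, then `Y` is the carrier of a Mathlib `Delone.DeloneSet` (packing radius `δ/2`, covering radius
`max R₀ 1`): `count|S = count|S'` forces `S = S'` (`count_restrict_singleton_ne_zero_iff`), separation and
covering pull back along the isometry `s ↦ A (s - q)`.  Leans on: `Literature.Probability.Process.IsRootedHardCore`,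
`count_restrict_singleton_ne_zero_iff`, `Delone.DeloneSet`, `Metric.IsSeparated`, `Metric.IsCover`. -/
theorem stub_deloneOfRealisedClass : ∀ δ : ℝ, 0 < δ → ∀ (Y : Set (EuclideanSpace ℝ (Fin 3))) (A : EuclideanSpace ℝ (Fin 3) →ₗᵢ[ℝ] EuclideanSpace ℝ (Fin 3)) (q : EuclideanSpace ℝ (Fin 3)), Literature.Probability.Process.IsRootedHardCore δ ((MeasureTheory.Measure.count : MeasureTheory.Measure (EuclideanSpace ℝ (Fin 3))).restrict ((fun s => A (s - q)) '' Y)) → (∃ R₀ : ℝ, ∀ z : EuclideanSpace ℝ (Fin 3), ∃ y : EuclideanSpace ℝ (Fin 3), ((MeasureTheory.Measure.count : MeasureTheory.Measure (EuclideanSpace ℝ (Fin 3))).restrict ((fun s => A (s - q)) '' Y)) {y} ≠ 0 ∧ dist z y ≤ R₀) → ∃ D : Delone.DeloneSet (EuclideanSpace ℝ (Fin 3)), (D : Set (EuclideanSpace ℝ (Fin 3))) = Y := by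
  sorry

/-- **S2 (= birth stub 2) — Giry measurability of a rooted isometry class** (size L).  For a Delone
`D ⊆ ℝ³` and any `q`, `{count|A(D − q) : A a linear isometry}` is measurable in `Measure.instMeasurableSpace`.
Routes: (a) birth's — finite nets of the compact `O(3)` tested against a countable family of tents, limit
point + uniqueness of locally finite measures on a π-system; (b) the refuter's — box-profile map
`μ ↦ (μ B_k)_k` into a countably separated space + a finite-to-one Borel image (`MeasurableSet.image_of_measurable_injOn`
on a Borel transversal of the finite stabiliser); (c) a frame trick — `μ` is in the class iff some TRIPLE of
its own atoms `(y₁,y₂,y₃)` has the Gram matrix of a fixed frame `(f₁,f₂,f₃) ⊆ D − q` and `μ` agrees with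
`count|A_{y}(D − q)` on the countably many evaluations that pin a counting measure, an `∃` over atoms of `μ`
being a positivity condition on a triple `lintegral` against truncated finite kernels `μ ↦ μ|B̄(0,n)`
(`Measurable.lintegral_kernel_prod_right`).  Leans on: `Measure.instMeasurableSpace`, `Measure.measurable_coe`,
`Measure.ext_of_generateFrom_of_iUnion`, compactness of `O(3)`; LastPenrose2017 Ch. 2. -/
theorem stub_measurableSet_isometryClass : ∀ (D : Delone.DeloneSet (EuclideanSpace ℝ (Fin 3))) (q : EuclideanSpace ℝ (Fin 3)), MeasurableSet {μ : MeasureTheory.Measure (EuclideanSpace ℝ (Fin 3)) | ∃ A : EuclideanSpace ℝ (Fin 3) →ₗᵢ[ℝ] EuclideanSpace ℝ (Fin 3), μ = (MeasureTheory.Measure.count : MeasureTheory.Measure (EuclideanSpace ℝ (Fin 3))).restrict ((fun s => A (s - q)) '' (D : Set (EuclideanSpace ℝ (Fin 3))))} := by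
  sorry

/-- **S3 (= birth stub 3) — mass transport: a charged isometry class has an orbit of CUBIC growth**
(size L; the route's NEW Palm lever).  For `δ > 0`, a point-stationary probability law, a.s. rooted
`δ`-hard-core, and a Delone `D` whose rooted isometry classes are measurable and whose atom event has positive
mass: some `q ∈ D`, `c > 0` have `c·r³ ≤ #{p ∈ Sym(D)·q : dist p q ≤ r}` for `r ≥ 1`.  Proof: the atom event is
the countable union over orbits `a ∈ D/Sym(D)` of class events `C_a`, so `m(a) := P(C_a) > 0` for some `a`
(σ-subadditivity); Mecke with `g(μ, y) = 1_{C_a}(μ)·1{‖y‖ ≤ r}`: LHS `= m(a)·#(D ∩ B̄(q_a, r)) ≥ m(a)c₀r³`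
(relative density), RHS `= Σ_b m(b)·#(Sym(D)q_a ∩ B̄(q_b, r)) ≤ sup_p #(Sym(D)q_a ∩ B̄(p, r))` (a.s. rootedness:
a re-rooted configuration in `C_a` comes from the atom; `Σ_b m(b) ≤ 1`); a ball of radius `r` holding that
many orbit points is recentred at `q_a` with radius `2r` by transitivity.  PROVER CAUTION (refuter): evaluate
the Mecke right-hand side only `P`-a.e. on a measurable full-measure set of rooted hard-core configurations
(`lintegral_congr_ae`).  Leans on: `IsPointStationaryLaw`, `map_sub_count_restrict`, `IsRootedHardCore.map_sub`,
`count_restrict_singleton_ne_zero_iff`, `Theorems.MinimiserShells.Negative.Rootedness.isPointStationaryLaw_restrict`;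
HevelingLast2005, LastPenrose2017 §9.3, AldousLyons2007 §2. -/
theorem stub_cubicGrowthOfChargedClass : ∀ δ : ℝ, 0 < δ → ∀ P : MeasureTheory.Measure (MeasureTheory.Measure (EuclideanSpace ℝ (Fin 3))), MeasureTheory.IsProbabilityMeasure P → (∀ᵐ μ ∂P, Literature.Probability.Process.IsRootedHardCore δ μ) → Literature.Probability.Process.IsPointStationaryLaw P → ∀ D : Delone.DeloneSet (EuclideanSpace ℝ (Fin 3)), (∀ q : EuclideanSpace ℝ (Fin 3), MeasurableSet {μ : MeasureTheory.Measure (EuclideanSpace ℝ (Fin 3)) | ∃ A : EuclideanSpace ℝ (Fin 3) →ₗᵢ[ℝ] EuclideanSpace ℝ (Fin 3), μ = (MeasureTheory.Measure.count : MeasureTheory.Measure (EuclideanSpace ℝ (Fin 3))).restrict ((fun s => A (s - q)) '' (D : Set (EuclideanSpace ℝ (Fin 3))))}) → 0 < P {μ | ∃ A : EuclideanSpace ℝ (Fin 3) →ₗᵢ[ℝ] EuclideanSpace ℝ (Fin 3), ∃ q ∈ (D : Set (EuclideanSpace ℝ (Fin 3))), μ = (MeasureTheory.Measure.count : MeasureTheory.Measure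 (EuclideanSpace ℝ (Fin 3))).restrict ((fun s => A (s - q)) '' (D : Set (EuclideanSpace ℝ (Fin 3))))} → ∃ q ∈ (D : Set (EuclideanSpace ℝ (Fin 3))), ∃ c : ℝ, 0 < c ∧ ∀ r : ℝ, 1 ≤ r → c * r ^ 3 ≤ (Nat.card {p : EuclideanSpace ℝ (Fin 3) // (∃ g : EuclideanSpace ℝ (Fin 3) ≃ᵃⁱ[ℝ] EuclideanSpace ℝ (Fin 3), g '' (D : Set (EuclideanSpace ℝ (Fin 3))) = (D : Set (EuclideanSpace ℝ (Fin 3))) ∧ g q = p) ∧ dist p q ≤ r} : ℝ) := by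
  sorry

/-! ## The new geometric back end G1a, G1b, G2, G3 (elementary Bieberbach I in `ℝ³`; no named facts) -/

/-- **G1a — SMALL LINEAR PARTS OF SYMMETRIES OF A DELONE SET COMMUTE** (size L; Frobenius–Bieberbach
commutator contraction in `SO(3)`).  For any Delone `D ⊆ ℝ³` and `g₁, g₂ ∈ Sym(D)` with
`‖gᵢ.linear x - x‖ ≤ ‖x‖/10`, the linear parts commute.  Why plausibly true: module docstring (iterated
commutators `κ_{j+1} = [g₁, κ_j]` stay in `Sym(D)`, are non-trivial by the axis criterion for commuting small
rotations of `ℝ³`, and converge to the identity — linear parts `≤ (1/5)ʲ/10`, translation parts by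
`b_{j+1} ≤ c_j a + (1/10 + c_{j+1}) b_j` —, while a symmetry of a Delone set moving the points of an affinely
spanning patch by less than the packing radius is the identity).  Why it might fail: only if the constant were
too large for the contraction (`1/10`: factor `2/10 + …  < 1`, fine) or if `Sym(D)` were not discrete (it is:
uniform discreteness + relative density of `D`).  Leans on: `AffineIsometryEquiv` (`.linear`, composition),
`LinearIsometryEquiv`, `Module.End` eigenspaces and fixed spaces in `EuclideanSpace ℝ (Fin 3)` (an orthogonal map of
`ℝ³` within `1/10` of `1` has a fixed unit vector and no eigenvalue `-1`), `Delone.DeloneSet.packingRadius_lt_dist_of_mem_ne`,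
`Delone.DeloneSet.exists_dist_le_coveringRadius`; Buser 1985 (geometric proof of Bieberbach), Thurston 1997
§4.1 (discrete Euclidean groups are almost abelian), Wolf 2011 §3.2. -/
theorem stub_smallPartsCommute : ∀ D : Delone.DeloneSet (EuclideanSpace ℝ (Fin 3)), ∀ g₁ g₂ : EuclideanSpace ℝ (Fin 3) ≃ᵃⁱ[ℝ] EuclideanSpace ℝ (Fin 3), g₁ '' (D : Set (EuclideanSpace ℝ (Fin 3))) = (D : Set (EuclideanSpace ℝ (Fin 3))) → g₂ '' (D : Set (EuclideanSpace ℝ (Fin 3))) = (D : Set (EuclideanSpace ℝ (Fin 3))) → (∀ x : EuclideanSpace ℝ (Fin 3), ‖g₁.linear x - x‖ ≤ ‖x‖ / 10) → (∀ x : EuclideanSpace ℝ (Fin 3), ‖g₂.linear x - x‖ ≤ ‖x‖ / 10) → ∀ x : EuclideanSpace ℝ (Fin 3), g₁.linear (g₂.linear x) = g₂.linear (g₁.linear x) := by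
  sorry

/-- **G1b — WITH A CUBIC-GROWTH ORBIT, A SYMMETRY WITH SMALL LINEAR PART IS A TRANSLATION** (size L;
screw-axis exclusion).  If `Sym(D)·q` has cubic growth for some `q ∈ D` and small linear parts of symmetries
pairwise commute (the conclusion of G1a, taken as a hypothesis), then every `g ∈ Sym(D)` with
`‖g.linear x - x‖ ≤ ‖x‖/10` has `g.linear = 1`.  Why plausibly true: module docstring (a small `A₀ ≠ 1` is a
rotation by `θ₀ ≤ 0.1` about `u`; conjugates are small so `Sym(D)` preserves `±u`; either `Sym(D)` preserves the
screw axis `ℓ` of `g` — then the orbit of `q` lives on one cylinder and has `O(r)` growth — or some `h` moves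
`ℓ` to a parallel line at distance `d > 0`, and `[g, hgh⁻¹]` is a translation by `w ⊥ u`, `w ≠ 0`; the
translations of `Sym(D)` in `u^⊥` form an `A₀`-stable uniformly discrete subgroup whose shortest vector `v`
is beaten by `A₀ v - v`).  Why it might fail: only through a gap in the case analysis (screws with
`Bu = -u` give angle `-θ₀`: covered, `|w| = d(2 sin(θ₀/2))²` either way) — no counterexample: in a periodic
crystal every rotation angle is `≥ 60°`, and the irrational-screw Delone sets (twisted stacks
`⋃ₙ (R_{nα}ℤ² + n e₃)`) have orbits of LINEAR growth, excluded by the hypothesis.  Leans on: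
`AffineIsometryEquiv`, conjugation of translations (`g τ_v g⁻¹ = τ_{g.linear v}`), plane rotations
(`I - R_θ` invertible for `θ ∉ 2πℤ`), `Delone.DeloneSet.packingRadius_lt_dist_of_mem_ne`, `Nat.card` /
`Set.Finite` counting of a uniformly discrete set on a cylinder; DolbilinLagariasSenechal1998 §2 (orbit
arguments), Thurston 1997 Prop. 4.2.5. -/
theorem stub_noSmallRotation : ∀ D : Delone.DeloneSet (EuclideanSpace ℝ (Fin 3)), (∃ q ∈ (D : Set (EuclideanSpace ℝ (Fin 3))), ∃ c : ℝ, 0 < c ∧ ∀ r : ℝ, 1 ≤ r → c * r ^ 3 ≤ (Nat.card {p : EuclideanSpace ℝ (Fin 3) // (∃ g : EuclideanSpace ℝ (Fin 3) ≃ᵃⁱ[ℝ] EuclideanSpace ℝ (Fin 3), g '' (D : Set (EuclideanSpace ℝ (Fin 3))) = (D : Set (EuclideanSpace ℝ (Fin 3))) ∧ g q = p) ∧ dist p q ≤ r} : ℝ)) → (∀ g₁ g₂ : EuclideanSpace ℝ (Fin 3) ≃ᵃⁱ[ℝ] EuclideanSpace ℝ (Fin 3), g₁ '' (D : Set (EuclideanSpace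 ℝ (Fin 3))) = (D : Set (EuclideanSpace ℝ (Fin 3))) → g₂ '' (D : Set (EuclideanSpace ℝ (Fin 3))) = (D : Set (EuclideanSpace ℝ (Fin 3))) → (∀ x : EuclideanSpace ℝ (Fin 3), ‖g₁.linear x - x‖ ≤ ‖x‖ / 10) → (∀ x : EuclideanSpace ℝ (Fin 3), ‖g₂.linear x - x‖ ≤ ‖x‖ / 10) → ∀ x : EuclideanSpace ℝ (Fin 3), g₁.linear (g₂.linear x) = g₂.linear (g₁.linear x)) → ∀ g : EuclideanSpace ℝ (Fin 3) ≃ᵃⁱ[ℝ] EuclideanSpace ℝ (Fin 3), g '' (D : Set (EuclideanSpace ℝ (Fin 3))) = (D : Set (EuclideanSpace ℝ (Fin 3))) → (∀ x : EuclideanSpace ℝ (Fin 3), ‖g.linear x - x‖ ≤ ‖x‖ / 10) → ∀ x : EuclideanSpace ℝ (Fin 3), g.linear x = x := by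
  sorry

/-- **G2 — NO SMALL ROTATION + CUBIC GROWTH ⇒ A FULL-RANK LATTICE OF PERIODS** (size L; pigeonhole on a
finite point group).  If `Sym(D)·q` has cubic growth and every symmetry with small linear part is a
translation, there is a discrete full-rank `ℤ`-submodule `L ⊆ ℝ³` (`IsZLattice`) of periods of `D`
(`x + v ∈ D` for `x ∈ D`, `v ∈ L`).  Why plausibly true: module docstring (point group `1/10`-separated in
operator norm hence of cardinality `≤ h`, a covering number of `O(3)`; `≥ c r³/h` of the symmetries carrying
`q` into `B̄(q, r)` share a linear part, their quotients are translations by the `≥ c r³/h - 1` vectors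
`p - p₀ ∈ B̄(0, 2r)`; the translation vectors form a uniformly discrete additive subgroup, which must span `ℝ³`
since a uniformly discrete subset of a plane has `O(r²)` points in `B̄(0, 2r)`; take `L =` that subgroup as a
`ℤ`-submodule).  Why it might fail: no mathematical gap (it is the classical "finite point group ⇒ lattice of
finite index" step); Lean cost = a covering number of `O(3)` and a planar packing count.  Leans on:
`AddSubgroup.toIntSubmodule`, `IsZLattice` (field `span_top`), `DiscreteTopology` of a uniformly discrete
subgroup, `Finset.exists_lt_card_fiber_of_mul_lt_card_of_maps_to` (pigeonhole), `Delone.DeloneSet`;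
GrahamGrotschelLovasz1996 ch. 19 Thm 5.2, DolbilinLagariasSenechal1998 Thm 2.1. -/
theorem stub_latticeOfNoSmallRotation : ∀ D : Delone.DeloneSet (EuclideanSpace ℝ (Fin 3)), (∃ q ∈ (D : Set (EuclideanSpace ℝ (Fin 3))), ∃ c : ℝ, 0 < c ∧ ∀ r : ℝ, 1 ≤ r → c * r ^ 3 ≤ (Nat.card {p : EuclideanSpace ℝ (Fin 3) // (∃ g : EuclideanSpace ℝ (Fin 3) ≃ᵃⁱ[ℝ] EuclideanSpace ℝ (Fin 3), g '' (D : Set (EuclideanSpace ℝ (Fin 3))) = (D : Set (EuclideanSpace ℝ (Fin 3))) ∧ g q = p) ∧ dist p q ≤ r} : ℝ)) → (∀ g : EuclideanSpace ℝ (Fin 3) ≃ᵃⁱ[ℝ] EuclideanSpace ℝ (Fin 3), g '' (D : Set (EuclideanSpace ℝ (Fin 3))) = (D : Set (EuclideanSpace ℝ (Fin 3))) → (∀ x : EuclideanSpace ℝ (Fin 3), ‖g.linear x - x‖ ≤ ‖x‖ / 10) → ∀ x : EuclideanSpace ℝ (Fin 3), g.linear x = x) → ∃ L : Submodule ℤ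 (EuclideanSpace ℝ (Fin 3)), ∃ _ : DiscreteTopology L, IsZLattice ℝ L ∧ ∀ v ∈ L, ∀ x ∈ (D : Set (EuclideanSpace ℝ (Fin 3))), x + v ∈ (D : Set (EuclideanSpace ℝ (Fin 3))) := by
  sorry

/-- **G3 — A NON-EMPTY UNIFORMLY DISCRETE SET INVARIANT UNDER A FULL LATTICE IS A `PeriodicConfiguration 3`**
(size M; packaging).  If `Y ≠ ∅` is uniformly discrete and `y + v ∈ Y` for all `y ∈ Y`, `v ∈ L` with `L` a
discrete full-rank `ℤ`-submodule, then `Y = Q.points` for some `Q : PeriodicConfiguration 3` (lattice `L`, motif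
`Y ∩ 𝓓` for the `ZSpan` fundamental domain `𝓓` of a `ℤ`-basis of `L`).  Why plausibly true: `𝓓` is bounded so
`Y ∩ 𝓓` is finite (uniform discreteness) and non-empty (`ZSpan.fract` of a point of `Y` lies in `Y ∩ 𝓓` by
`L`-invariance, `-v ∈ L`); motif points are pairwise inequivalent (`ZSpan.exist_unique_vadd_mem_fundamentalDomain`);
`Q.points = (Y ∩ 𝓓) + L = Y` (`y = fract y + floor y`).  Why it might fail: only through the side conditions of
the structure (`motif_nonempty`, `eq_of_sub_mem`) — covered as said.  Leans on:
`Literature.MathematicalPhysics.StatisticalMechanics.PeriodicConfiguration` (`.points`), `IsZLattice`,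
`ZLattice.module_free`, `Module.Free.chooseBasis`, `Basis.ofZLatticeBasis`, `Basis.ofZLatticeBasis_span`,
`ZSpan.fundamentalDomain`, `ZSpan.fract_mem_fundamentalDomain`, `ZSpan.fundamentalDomain_isBounded`,
`Metric.finite_isBounded_inter_isClosed`. -/
theorem stub_periodicOfLattice : ∀ Y : Set (EuclideanSpace ℝ (Fin 3)), Y.Nonempty → (∃ ρ : ℝ, 0 < ρ ∧ ∀ x ∈ Y, ∀ y ∈ Y, x ≠ y → ρ ≤ dist x y) → ∀ L : Submodule ℤ (EuclideanSpace ℝ (Fin 3)), ∀ _ : DiscreteTopology L, IsZLattice ℝ L → (∀ v ∈ L, ∀ y ∈ Y, y + v ∈ Y) → ∃ Q : Literature.MathematicalPhysics.StatisticalMechanics.PeriodicConfiguration 3, Q.points = Y := by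
  sorry


/-! ## Composition (sorry-free) -/

/-- **Composition with explicit hypotheses** (sorry-free): the seven stubs' STATEMENTS, verbatim, imply the
BODY of the crux verbatim (`AtomicLawChargesCrystal` unfolded — see `crux_iff`).  Steps proved here: (A)
extraction of one realised hard-core, relatively dense copy of `Y` from the positive-measure atom event and the
two a.s. clauses; (B)–(D) the chain S1 → (S2, S3) → G1a → G1b → G2 → G3 (the uniform discreteness fed to G3 is
the packing radius of the Delone structure from S1); (E) the atom event is contained in every
`(R, ε)`-matching event of `Q` once `Q.points = Y`. -/
theorem AtomicLawChargesCrystal_of_stubs :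
    (∀ δ : ℝ, 0 < δ → ∀ (Y : Set (EuclideanSpace ℝ (Fin 3))) (A : EuclideanSpace ℝ (Fin 3) →ₗᵢ[ℝ] EuclideanSpace ℝ (Fin 3)) (q : EuclideanSpace ℝ (Fin 3)), Literature.Probability.Process.IsRootedHardCore δ ((MeasureTheory.Measure.count : MeasureTheory.Measure (EuclideanSpace ℝ (Fin 3))).restrict ((fun s => A (s - q)) '' Y)) → (∃ R₀ : ℝ, ∀ z : EuclideanSpace ℝ (Fin 3), ∃ y : EuclideanSpace ℝ (Fin 3), ((MeasureTheory.Measure.count : MeasureTheory.Measure (EuclideanSpace ℝ (Fin 3))).restrict ((fun s => A (s - q)) '' Y)) {y} ≠ 0 ∧ dist z y ≤ R₀) → ∃ D : Delone.DeloneSet (EuclideanSpace ℝ (Fin 3)), (D : Set (EuclideanSpace ℝ (Fin 3))) = Y) →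
    (∀ (D : Delone.DeloneSet (EuclideanSpace ℝ (Fin 3))) (q : EuclideanSpace ℝ (Fin 3)), MeasurableSet {μ : MeasureTheory.Measure (EuclideanSpace ℝ (Fin 3)) | ∃ A : EuclideanSpace ℝ (Fin 3) →ₗᵢ[ℝ] EuclideanSpace ℝ (Fin 3), μ = (MeasureTheory.Measure.count : MeasureTheory.Measure (EuclideanSpace ℝ (Fin 3))).restrict ((fun s => A (s - q)) '' (D : Set (EuclideanSpace ℝ (Fin 3))))}) →
    (∀ δ : ℝ, 0 < δ → ∀ P : MeasureTheory.Measure (MeasureTheory.Measure (EuclideanSpace ℝ (Fin 3))), MeasureTheory.IsProbabilityMeasure P → (∀ᵐ μ ∂P, Literature.Probability.Process.IsRootedHardCore δ μ) → Literature.Probability.Process.IsPointStationaryLaw P → ∀ D : Delone.DeloneSet (EuclideanSpace ℝ (Fin 3)), (∀ q : EuclideanSpace ℝ (Fin 3), MeasurableSet {μ : MeasureTheory.Measure (EuclideanSpace ℝ (Fin 3)) | ∃ A : EuclideanSpace ℝ (Fin 3) →ₗᵢ[ℝ] EuclideanSpace ℝ (Fin 3), μ = (MeasureTheory.Measure.count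 : MeasureTheory.Measure (EuclideanSpace ℝ (Fin 3))).restrict ((fun s => A (s - q)) '' (D : Set (EuclideanSpace ℝ (Fin 3))))}) → 0 < P {μ | ∃ A : EuclideanSpace ℝ (Fin 3) →ₗᵢ[ℝ] EuclideanSpace ℝ (Fin 3), ∃ q ∈ (D : Set (EuclideanSpace ℝ (Fin 3))), μ = (MeasureTheory.Measure.count : MeasureTheory.Measure (EuclideanSpace ℝ (Fin 3))).restrict ((fun s => A (s - q)) '' (D : Set (EuclideanSpace ℝ (Fin 3))))} → ∃ q ∈ (D : Set (EuclideanSpace ℝ (Fin 3))), ∃ c : ℝ, 0 < c ∧ ∀ r : ℝ, 1 ≤ r → c * r ^ 3 ≤ (Nat.card {p : EuclideanSpace ℝ (Fin 3) // (∃ g : EuclideanSpace ℝ (Fin 3) ≃ᵃⁱ[ℝ] EuclideanSpace ℝ (Fin 3), g '' (D : Set (EuclideanSpace ℝ (Fin 3))) = (D : Set (EuclideanSpace ℝ (Fin 3))) ∧ g q = p) ∧ dist p q ≤ r} : ℝ)) →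
    (∀ D : Delone.DeloneSet (EuclideanSpace ℝ (Fin 3)), ∀ g₁ g₂ : EuclideanSpace ℝ (Fin 3) ≃ᵃⁱ[ℝ] EuclideanSpace ℝ (Fin 3), g₁ '' (D : Set (EuclideanSpace ℝ (Fin 3))) = (D : Set (EuclideanSpace ℝ (Fin 3))) → g₂ '' (D : Set (EuclideanSpace ℝ (Fin 3))) = (D : Set (EuclideanSpace ℝ (Fin 3))) → (∀ x : EuclideanSpace ℝ (Fin 3), ‖g₁.linear x - x‖ ≤ ‖x‖ / 10) → (∀ x : EuclideanSpace ℝ (Fin 3), ‖g₂.linear x - x‖ ≤ ‖x‖ / 10) → ∀ x : EuclideanSpace ℝ (Fin 3), g₁.linear (g₂.linear x) = g₂.linear (g₁.linear x)) →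
    (∀ D : Delone.DeloneSet (EuclideanSpace ℝ (Fin 3)), (∃ q ∈ (D : Set (EuclideanSpace ℝ (Fin 3))), ∃ c : ℝ, 0 < c ∧ ∀ r : ℝ, 1 ≤ r → c * r ^ 3 ≤ (Nat.card {p : EuclideanSpace ℝ (Fin 3) // (∃ g : EuclideanSpace ℝ (Fin 3) ≃ᵃⁱ[ℝ] EuclideanSpace ℝ (Fin 3), g '' (D : Set (EuclideanSpace ℝ (Fin 3))) = (D : Set (EuclideanSpace ℝ (Fin 3))) ∧ g q = p) ∧ dist p q ≤ r} : ℝ)) → (∀ g₁ g₂ : EuclideanSpace ℝ (Fin 3) ≃ᵃⁱ[ℝ] EuclideanSpace ℝ (Fin 3), g₁ '' (D : Set (EuclideanSpace ℝ (Fin 3))) = (D : Set (EuclideanSpace ℝ (Fin 3))) → g₂ '' (D : Set (EuclideanSpace ℝ (Fin 3))) = (D : Set (EuclideanSpace ℝ (Fin 3))) → (∀ x : EuclideanSpace ℝ (Fin 3), ‖g₁.linear x - x‖ ≤ ‖x‖ / 10) → (∀ x : EuclideanSpace ℝ (Fin 3), ‖g₂.linear x - x‖ ≤ ‖x‖ /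 10) → ∀ x : EuclideanSpace ℝ (Fin 3), g₁.linear (g₂.linear x) = g₂.linear (g₁.linear x)) → ∀ g : EuclideanSpace ℝ (Fin 3) ≃ᵃⁱ[ℝ] EuclideanSpace ℝ (Fin 3), g '' (D : Set (EuclideanSpace ℝ (Fin 3))) = (D : Set (EuclideanSpace ℝ (Fin 3))) → (∀ x : EuclideanSpace ℝ (Fin 3), ‖g.linear x - x‖ ≤ ‖x‖ / 10) → ∀ x : EuclideanSpace ℝ (Fin 3), g.linear x = x) →
    (∀ D : Delone.DeloneSet (EuclideanSpace ℝ (Fin 3)), (∃ q ∈ (D : Set (EuclideanSpace ℝ (Fin 3))), ∃ c : ℝ, 0 < c ∧ ∀ r : ℝ, 1 ≤ r → c * r ^ 3 ≤ (Nat.card {p : EuclideanSpace ℝ (Fin 3) // (∃ g : EuclideanSpace ℝ (Fin 3) ≃ᵃⁱ[ℝ] EuclideanSpace ℝ (Fin 3), g '' (D : Set (EuclideanSpace ℝ (Fin 3))) = (D : Set (EuclideanSpace ℝ (Fin 3))) ∧ g q = p) ∧ dist p q ≤ r} : ℝ)) → (∀ g : EuclideanSpace ℝ (Fin 3) ≃ᵃⁱ[ℝ]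 EuclideanSpace ℝ (Fin 3), g '' (D : Set (EuclideanSpace ℝ (Fin 3))) = (D : Set (EuclideanSpace ℝ (Fin 3))) → (∀ x : EuclideanSpace ℝ (Fin 3), ‖g.linear x - x‖ ≤ ‖x‖ / 10) → ∀ x : EuclideanSpace ℝ (Fin 3), g.linear x = x) → ∃ L : Submodule ℤ (EuclideanSpace ℝ (Fin 3)), ∃ _ : DiscreteTopology L, IsZLattice ℝ L ∧ ∀ v ∈ L, ∀ x ∈ (D : Set (EuclideanSpace ℝ (Fin 3))), x + v ∈ (D : Set (EuclideanSpace ℝ (Fin 3)))) →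
    (∀ Y : Set (EuclideanSpace ℝ (Fin 3)), Y.Nonempty → (∃ ρ : ℝ, 0 < ρ ∧ ∀ x ∈ Y, ∀ y ∈ Y, x ≠ y → ρ ≤ dist x y) → ∀ L : Submodule ℤ (EuclideanSpace ℝ (Fin 3)), ∀ _ : DiscreteTopology L, IsZLattice ℝ L → (∀ v ∈ L, ∀ y ∈ Y, y + v ∈ Y) → ∃ Q : Literature.MathematicalPhysics.StatisticalMechanics.PeriodicConfiguration 3, Q.points = Y) →
    (∀ δ : ℝ, 0 < δ → ∀ P : MeasureTheory.Measure (MeasureTheory.Measure (EuclideanSpace ℝ (Fin 3))), MeasureTheory.IsProbabilityMeasure P → (∀ᵐ μ ∂P, Literature.Probability.Process.IsRootedHardCore δ μ) → Literature.Probability.Process.IsPointStationaryLaw P → (∀ᵐ μ ∂P, ∃ R₀ : ℝ, ∀ z : EuclideanSpace ℝ (Fin 3), ∃ y : EuclideanSpace ℝ (Fin 3), μ {y} ≠ 0 ∧ dist z y ≤ R₀) → (∃ Y : Set (EuclideanSpace ℝ (Fin 3)), 0 < P {μ | ∃ A : EuclideanSpace ℝ (Fin 3) →ₗᵢ[ℝ]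 EuclideanSpace ℝ (Fin 3), ∃ q ∈ Y, μ = (MeasureTheory.Measure.count : MeasureTheory.Measure (EuclideanSpace ℝ (Fin 3))).restrict ((fun s => A (s - q)) '' Y)}) → ∃ Q : Literature.MathematicalPhysics.StatisticalMechanics.PeriodicConfiguration 3, ∀ R ε : ℝ, 0 < R → 0 < ε → 0 < P {μ | ∃ A : EuclideanSpace ℝ (Fin 3) →ₗᵢ[ℝ] EuclideanSpace ℝ (Fin 3), ∃ q ∈ Q.points, (∀ s ∈ Q.points, dist s q ≤ R → ∃ y : EuclideanSpace ℝ (Fin 3), μ {y} ≠ 0 ∧ dist y (A (s - q)) ≤ ε) ∧ (∀ y : EuclideanSpace ℝ (Fin 3), μ {y} ≠ 0 → ‖y‖ ≤ R → ∃ s ∈ Q.points, dist y (A (s - q)) ≤ ε)}) := by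
  intro h1 h2 h3 h4 h5 h6 h7 δ hδ P hP hHC hSt hRD hAtom
  obtain ⟨Y, hY⟩ := hAtom
  -- (A) EXTRACTION: the atom event has positive measure, the hard-core and relative-density clauses hold
  -- a.s., so one configuration in the atom event satisfies both.
  obtain ⟨μ, ⟨A, q, hq, rfl⟩, hμhc, hμrd⟩ :=
    MeasureTheory.Measure.exists_mem_of_measure_ne_zero_of_ae hY.ne'
      (MeasureTheory.ae_restrict_of_ae (hHC.and hRD))
  -- (B) S1: `Y` is a Delone set.
  obtain ⟨D, hDY⟩ := h1 δ hδ Y A q hμhc hμrd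
  subst hDY
  -- (C) S2 + S3: an orbit of cubic growth; G1a + G1b: no small rotation; G2: a full lattice of periods.
  have hgrowth := h3 δ hδ P hP hHC hSt D (h2 D) hY
  have hnorot := h5 D hgrowth (h4 D)
  obtain ⟨L, hLd, hLz, hLinv⟩ := h6 D hgrowth hnorot
  -- (D) G3: `Y = Q.points` for a periodic configuration `Q` (uniform discreteness = packing radius of `D`).
  have hsep : ∃ ρ : ℝ, 0 < ρ ∧ ∀ x ∈ (D : Set (EuclideanSpace ℝ (Fin 3))),
      ∀ y ∈ (D : Set (EuclideanSpace ℝ (Fin 3))), x ≠ y → ρ ≤ dist x y :=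
    ⟨(D.packingRadius : ℝ), NNReal.coe_pos.mpr D.packingRadius_pos,
      fun x hx y hy hxy => (D.packingRadius_lt_dist_of_mem_ne hx hy hxy).le⟩
  obtain ⟨Q, hQ⟩ := h7 (D : Set (EuclideanSpace ℝ (Fin 3))) ⟨q, hq⟩ hsep L hLd hLz
    (fun v hv y hy => hLinv v hv y hy)
  -- (E) WINDOWS: the atom event lies inside every matching event of `Q`.
  refine ⟨Q, fun R ε hR hε => lt_of_lt_of_le hY (MeasureTheory.measure_mono ?_)⟩
  rintro μ ⟨A', q', hq', rfl⟩
  refine ⟨A', q', ?_, ?_, ?_⟩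
  · rw [hQ]; exact hq'
  · intro s hs _
    refine ⟨A' (s - q'), ?_, (dist_self _).trans_le hε.le⟩
    rw [Literature.Probability.Process.count_restrict_singleton_ne_zero_iff]
    exact ⟨s, hQ ▸ hs, rfl⟩
  · intro y hy _
    rw [Literature.Probability.Process.count_restrict_singleton_ne_zero_iff] at hy
    obtain ⟨s, hs, rfl⟩ := hy
    refine ⟨s, ?_, (dist_self _).trans_le hε.le⟩
    rw [hQ]; exact hs

/-- **SKELETON THEOREM `AtomicLawChargesCrystal_of` — the crux BY NAME from the seven registered stubs**
(the only theorem of this file concluding `IsometryAtoms.AtomicLawChargesCrystal`; no hypotheses; its only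
`sorry`s are the ones inside `stub_*`). -/
theorem AtomicLawChargesCrystal_of :
    Summit.AtomisticToContinuum.Crystallization.Theses.IsometryAtoms.AtomicLawChargesCrystal :=
  crux_iff.mpr
    (AtomicLawChargesCrystal_of_stubs stub_deloneOfRealisedClass stub_measurableSet_isometryClass
      stub_cubicGrowthOfChargedClass stub_smallPartsCommute stub_noSmallRotation
      stub_latticeOfNoSmallRotation stub_periodicOfLattice)

end Summit.AtomisticToContinuum.Crystallization.Cruxes.AtomicLawChargesCrystal.So3Commutator

end
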